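import Mathlib
import HarnessLib
import Literature.Analysis.FluidPDE.BeltramiFlows

/-!
# The ABC 1:1:1 α-point is an EXACT axisymmetric Burgers strain `diag(√2, −√2/2, −√2/2)`
# (instab lane: the P-TOWER-1′ dictionary's `A_{k−1} ≡ σ_α = √2` and HEREDITY-P3's «parent's axisymmetric
# strain σ» at the host's own stagnation point, as kernel facts about the tree's `ABC.abc 1 1 1`)

HONEST FRAMING (cell `ns-blowup`, seat `ns-blowup-instab2`; human ruling D-0035): nothing here is a
claim about Navier–Stokes blow-up. WHAT THIS IS NOT: not dynamics; the elementary evaluation of the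
tree's ABC field `Literature.Analysis.FluidPDE.ABC.abc 1 1 1` = `(sin z + cos y, sin x + cos z, sin y + cos x)`
and of its Jacobian `ABC.jac` (row `j` = `∂/∂xⱼ`, column `i` = component; `fderiv_abc_single`) at the
points of the body diagonal — the classical stagnation skeleton of the `A = B = C` flow
[Dombre, Frisch, Greene, Hénon, Mehr, Soward, J. Fluid Mech. 167 (1986) 353–391, §4].

* `abc_diag`: on the diagonal `(s,s,s)` the field is `(sin s + cos s)·(1,1,1)` — the diagonal is an
  INVARIANT LINE carrying the one-dimensional flow `ṡ = sin s + cos s`;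
* `abc_alpha0_eq_zero`, `abc_beta0_eq_zero`: `α₀ = (7π/4, 7π/4, 7π/4)` and `β₀ = (3π/4, 3π/4, 3π/4)` are
  stagnation points (`sin + cos = 0` there); `alongLine_rate_alpha/_beta`: the along-line rate
  `d/ds (sin s + cos s) = cos s − sin s` is `+√2` at `α₀` (repelling) and `−√2` at `β₀` (attracting): the
  open diagonal segment from `α₀` to `β₀ ≡ α₀ + π(1,1,1)` is a straight heteroclinic streamline of length
  `π√3` (`heteroclinic_length`) — the «rope-carrying skeleton line» of the cell's memos;
* `jac_alpha0`: the Jacobian at `α₀` is `(√2/2)·(𝟙𝟙ᵀ − I)` — SYMMETRIC (`jac_alpha0_symm`: the host has NO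
  rotation at its α-point, pure strain) with `𝟙 = (1,1,1)` an eigenvector of eigenvalue `√2`
  (`gradU_alpha0_mulVec_ones`) and every transverse vector (`v₀+v₁+v₂ = 0`) an eigenvector of eigenvalue
  `−√2/2` (`gradU_alpha0_mulVec_transverse`): EXACTLY the axisymmetric strain `diag(σ, −σ/2, −σ/2)`,
  `σ = √2`, that `BurgersTubeHeredity` / `BurgersColumnarFlowMap` take as «the parent's strain» — so the
  P-TOWER-1′ dictionary entry `A_{k−1} ≡ σ_α = √2`, `τ_h = 1/σ_α` (NORMALISATIONS-OF-RECORD §1) is an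
  identity, not a fit; at `β₀` the signs flip (`jac_beta0`, eigenvalues `−√2` along the line, `+√2/2`
  twice transversally: type β);
* `curl_abc_alpha0`: the host vorticity vanishes at `α₀` (Beltrami: `curl U = U`), consistent with
  `StagnationPointIdentities` (S1);
* `fderiv_abc_eq_mulVec`: the link to the Fréchet derivative — `(D(abc)(x) v)ᵢ = Σⱼ vⱼ · jac x j i`.

Mathlib + `Literature.Analysis.FluidPDE.BeltramiFlows`. No definitions. LABEL: MODEL-door dictionary.
-/

namespace Summit.NavierStokesRegularity.FluidComputer.ABCAlphaPointStrain

open Real Literature.Analysis.FluidPDE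

/-! ## §1 Trigonometric values on the diagonal -/

/-- `sin(7π/4) = −√2/2`. -/
theorem sin_seven_pi_div_four : Real.sin (7 * π / 4) = -(Real.sqrt 2 / 2) := by
  have h : 7 * π / 4 = 2 * π - π / 4 := by ring
  rw [h, Real.sin_two_pi_sub, Real.sin_pi_div_four]

/-- `cos(7π/4) = √2/2`. -/
theorem cos_seven_pi_div_four : Real.cos (7 * π / 4) = Real.sqrt 2 / 2 := by
  have h : 7 * π / 4 = 2 * π - π / 4 := by ring
  rw [h, Real.cos_two_pi_sub, Real.cos_pi_div_four]

/-- `sin(3π/4) = √2/2`. -/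
theorem sin_three_pi_div_four : Real.sin (3 * π / 4) = Real.sqrt 2 / 2 := by
  have h : 3 * π / 4 = π - π / 4 := by ring
  rw [h, Real.sin_pi_sub, Real.sin_pi_div_four]

/-- `cos(3π/4) = −√2/2`. -/
theorem cos_three_pi_div_four : Real.cos (3 * π / 4) = -(Real.sqrt 2 / 2) := by
  have h : 3 * π / 4 = π - π / 4 := by ring
  rw [h, Real.cos_pi_sub, Real.cos_pi_div_four]

/-! ## §2 The invariant diagonal and its two stagnation points -/

/-- THE DIAGONAL IS INVARIANT: `abc 1 1 1 (s,s,s) = (sin s + cos s)·(1,1,1)`. -/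
theorem abc_diag (s : ℝ) :
    ABC.abc 1 1 1 (!₂[s, s, s] : EuclideanSpace ℝ (Fin 3)) = (Real.sin s + Real.cos s) • (!₂[1, 1, 1] : EuclideanSpace ℝ (Fin 3)) := by
  ext i
  fin_cases i <;> simp [ABC.abc]

/-- `α₀ = (7π/4, 7π/4, 7π/4)` is a stagnation point of `abc 1 1 1`. -/
theorem abc_alpha0_eq_zero : ABC.abc 1 1 1 (!₂[7 * π / 4, 7 * π / 4, 7 * π / 4] : EuclideanSpace ℝ (Fin 3)) = 0 := by
  rw [abc_diag, sin_seven_pi_div_four, cos_seven_pi_div_four]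
  simp

/-- `β₀ = (3π/4, 3π/4, 3π/4)` is a stagnation point of `abc 1 1 1`. -/
theorem abc_beta0_eq_zero : ABC.abc 1 1 1 (!₂[3 * π / 4, 3 * π / 4, 3 * π / 4] : EuclideanSpace ℝ (Fin 3)) = 0 := by
  rw [abc_diag, sin_three_pi_div_four, cos_three_pi_div_four]
  simp

/-- `β₀ ≡ α₀ + π·(1,1,1)` modulo the period `2π` in each coordinate: `7π/4 + π = 3π/4 + 2π`. -/
theorem beta0_eq_alpha0_add_pi : 7 * π / 4 + π = 3 * π / 4 + 2 * π := by ring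

/-- The along-line speed `sin s + cos s` has derivative `cos s − sin s`. -/
theorem hasDerivAt_alongLine (s : ℝ) :
    HasDerivAt (fun s => Real.sin s + Real.cos s) (Real.cos s - Real.sin s) s := by
  exact ((Real.hasDerivAt_sin s).add (Real.hasDerivAt_cos s)).congr_deriv (by ring)

/-- At `α₀` the along-line rate is `+√2`: the diagonal LEAVES `α₀` (its one-dimensional unstable manifold). -/
theorem alongLine_rate_alpha : Real.cos (7 * π / 4) - Real.sin (7 * π / 4) = Real.sqrt 2 := by
  rw [sin_seven_pi_div_four, cos_seven_pi_div_four]; ring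

/-- At `β₀` the along-line rate is `−√2`: the diagonal ARRIVES at `β₀` (its one-dimensional stable manifold). -/
theorem alongLine_rate_beta : Real.cos (3 * π / 4) - Real.sin (3 * π / 4) = -Real.sqrt 2 := by
  rw [sin_three_pi_div_four, cos_three_pi_div_four]; ring

/-- Between `α₀` and `β₀` the along-line speed does not vanish: `sin s + cos s < 0` for
`s ∈ (3π/4, 7π/4)` — the open segment is ONE heteroclinic streamline (traversed from `α₀` down to `β₀`
in the decreasing-`s` direction). -/
theorem alongLine_speed_neg {s : ℝ} (h1 : 3 * π / 4 < s) (h2 : s < 7 * π / 4) :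
    Real.sin s + Real.cos s < 0 := by
  have h22 : Real.sqrt 2 * (Real.sqrt 2 / 2) = 1 := by
    rw [← mul_div_assoc, Real.mul_self_sqrt (by norm_num : (0 : ℝ) ≤ 2)]; norm_num
  have key : Real.sin s + Real.cos s = Real.sqrt 2 * Real.sin (s + π / 4) := by
    rw [Real.sin_add, Real.sin_pi_div_four, Real.cos_pi_div_four]
    have e : Real.sqrt 2 * (Real.sin s * (Real.sqrt 2 / 2) + Real.cos s * (Real.sqrt 2 / 2))
        = (Real.sin s + Real.cos s) * (Real.sqrt 2 * (Real.sqrt 2 / 2)) := by ring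
    rw [e, h22, mul_one]
  rw [key]
  have hlt : Real.sin (s + π / 4) < 0 := by
    have e : Real.sin (s + π / 4) = -Real.sin (s + π / 4 - π) := by
      rw [Real.sin_sub_pi]; ring
    rw [e, neg_lt_zero]
    apply Real.sin_pos_of_pos_of_lt_pi <;> linarith
  have hsq : 0 < Real.sqrt 2 := by positivity
  nlinarith

/-- The heteroclinic segment `α₀ → β₀` along the diagonal has length `π·√3` (`|7π/4 − 3π/4|·‖(1,1,1)‖`). -/
theorem heteroclinic_length :
    dist (!₂[7 * π / 4, 7 * π / 4, 7 * π / 4] : EuclideanSpace ℝ (Fin 3)) (!₂[3 * π / 4, 3 * π / 4, 3 * π / 4] : EuclideanSpace ℝ (Fin 3)) = π * Real.sqrt 3 := by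
  rw [EuclideanSpace.dist_eq]
  simp only [Fin.sum_univ_three, Real.dist_eq, sq_abs]
  simp
  have h : (7 * π / 4 - 3 * π / 4) ^ 2 + (7 * π / 4 - 3 * π / 4) ^ 2 + (7 * π / 4 - 3 * π / 4) ^ 2 = (π * Real.sqrt 3) ^ 2 := by
    have h3 : Real.sqrt 3 ^ 2 = 3 := Real.sq_sqrt (by norm_num)
    nlinarith [h3]
  rw [h, Real.sqrt_sq (by positivity)]

/-! ## §3 The Jacobian at `α₀` and `β₀`: exact axisymmetric strain -/

/-- `jac 1 1 1 α₀ = (√2/2)·(𝟙𝟙ᵀ − I)`: all diagonal entries `0`, all off-diagonal entries `√2/2`. -/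
theorem jac_alpha0 (j i : Fin 3) :
    ABC.jac 1 1 1 (!₂[7 * π / 4, 7 * π / 4, 7 * π / 4] : EuclideanSpace ℝ (Fin 3)) j i = if j = i then 0 else Real.sqrt 2 / 2 := by
  fin_cases j <;> fin_cases i <;> simp [ABC.jac, sin_seven_pi_div_four, cos_seven_pi_div_four]

/-- `jac 1 1 1 β₀ = −(√2/2)·(𝟙𝟙ᵀ − I)`. -/
theorem jac_beta0 (j i : Fin 3) :
    ABC.jac 1 1 1 (!₂[3 * π / 4, 3 * π / 4, 3 * π / 4] : EuclideanSpace ℝ (Fin 3)) j i = if j = i then 0 else -(Real.sqrt 2 / 2) := by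
  fin_cases j <;> fin_cases i <;> simp [ABC.jac, sin_three_pi_div_four, cos_three_pi_div_four]

/-- PURE STRAIN AT α: the Jacobian at `α₀` is symmetric — the host contributes NO rotation at its own
α-point (its vorticity vanishes there, `curl_abc_alpha0`). -/
theorem jac_alpha0_symm (j i : Fin 3) :
    ABC.jac 1 1 1 (!₂[7 * π / 4, 7 * π / 4, 7 * π / 4] : EuclideanSpace ℝ (Fin 3)) j i = ABC.jac 1 1 1 (!₂[7 * π / 4, 7 * π / 4, 7 * π / 4] : EuclideanSpace ℝ (Fin 3)) i j := by
  rw [jac_alpha0, jac_alpha0]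
  by_cases h : j = i
  · subst h; simp
  · simp [h, Ne.symm h]

/-- THE STRETCHING RATE `σ_α = √2`: `(1,1,1)` is an eigenvector of `∇U(α₀)` with eigenvalue `√2`
(`(∇U v)ᵢ = Σⱼ vⱼ ∂ⱼUᵢ`). -/
theorem gradU_alpha0_mulVec_ones (i : Fin 3) :
    ∑ j : Fin 3, (1 : ℝ) * ABC.jac 1 1 1 (!₂[7 * π / 4, 7 * π / 4, 7 * π / 4] : EuclideanSpace ℝ (Fin 3)) j i = Real.sqrt 2 * 1 := by
  simp only [jac_alpha0, Fin.sum_univ_three]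
  fin_cases i <;> simp

/-- THE TRANSVERSE RATE `−σ_α/2 = −√2/2` (double, REAL): every `v` with `v₀ + v₁ + v₂ = 0` is an eigenvector
of `∇U(α₀)` with eigenvalue `−√2/2`. With `gradU_alpha0_mulVec_ones` this says `∇U(α₀) = diag(√2, −√2/2,
−√2/2)` in any orthonormal frame `(𝟙/√3, e₂, e₃)`: EXACTLY the axisymmetric Burgers strain of the heredity files. -/
theorem gradU_alpha0_mulVec_transverse (v : Fin 3 → ℝ) (hv : v 0 + v 1 + v 2 = 0) (i : Fin 3) :
    ∑ j : Fin 3, v j * ABC.jac 1 1 1 (!₂[7 * π / 4, 7 * π / 4, 7 * π / 4] : EuclideanSpace ℝ (Fin 3)) j i = -(Real.sqrt 2 / 2) * v i := by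
  simp only [jac_alpha0, Fin.sum_univ_three]
  fin_cases i <;> simp <;> linear_combination (Real.sqrt 2 / 2) * hv

/-- Incompressibility at `α₀`: `tr ∇U(α₀) = 0` (indeed `√2 − √2/2 − √2/2 = 0`). -/
theorem jac_alpha0_trace :
    ∑ i : Fin 3, ABC.jac 1 1 1 (!₂[7 * π / 4, 7 * π / 4, 7 * π / 4] : EuclideanSpace ℝ (Fin 3)) i i = 0 := by
  simp [jac_alpha0]

/-- At `β₀` the signs flip: `(1,1,1)` has eigenvalue `−√2` (the line arrives) … -/
theorem gradU_beta0_mulVec_ones (i : Fin 3) :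
    ∑ j : Fin 3, (1 : ℝ) * ABC.jac 1 1 1 (!₂[3 * π / 4, 3 * π / 4, 3 * π / 4] : EuclideanSpace ℝ (Fin 3)) j i = -Real.sqrt 2 * 1 := by
  simp only [jac_beta0, Fin.sum_univ_three]
  fin_cases i <;> simp <;> ring

/-- … and the transverse plane EXPANDS at `+√2/2` (twice): two positive real parts — type β, the end of the
rope-carrying line where the two halves of a diagonal rope collide (HEREDITY-P3 (D)(i): a SHEET site). -/
theorem gradU_beta0_mulVec_transverse (v : Fin 3 → ℝ) (hv : v 0 + v 1 + v 2 = 0) (i : Fin 3) :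
    ∑ j : Fin 3, v j * ABC.jac 1 1 1 (!₂[3 * π / 4, 3 * π / 4, 3 * π / 4] : EuclideanSpace ℝ (Fin 3)) j i = (Real.sqrt 2 / 2) * v i := by
  simp only [jac_beta0, Fin.sum_univ_three]
  fin_cases i <;> simp <;> linear_combination (-(Real.sqrt 2 / 2)) * hv

/-! ## §4 Vorticity at α and the link to the Fréchet derivative -/

/-- The host vorticity vanishes at `α₀` (`curl U = U` for the ABC flow, and `U(α₀) = 0`). -/
theorem curl_abc_alpha0 :
    curl (ABC.abc 1 1 1) (!₂[7 * π / 4, 7 * π / 4, 7 * π / 4] : EuclideanSpace ℝ (Fin 3)) = 0 := by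
  rw [ABC.curl_abc, abc_alpha0_eq_zero]

/-- THE LINK: the Fréchet derivative of the ABC field acts through `jac` —
`(D(abc A B C)(x) v)ᵢ = Σⱼ vⱼ · jac A B C x j i` for every `v` (linearity + `fderiv_abc_single`). -/
theorem fderiv_abc_eq_sum (A B C : ℝ) (x v : EuclideanSpace ℝ (Fin 3)) (i : Fin 3) :
    fderiv ℝ (ABC.abc A B C) x v i = ∑ j : Fin 3, v j * ABC.jac A B C x j i := by
  have hv : v = ∑ j : Fin 3, v j • (EuclideanSpace.single j (1 : ℝ) : EuclideanSpace ℝ (Fin 3)) := by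
    simpa [EuclideanSpace.basisFun_apply, EuclideanSpace.basisFun_repr] using
      ((EuclideanSpace.basisFun (Fin 3) ℝ).sum_repr v).symm
  conv_lhs => rw [hv]
  rw [map_sum]
  simp only [map_smul, WithLp.ofLp_sum, WithLp.ofLp_smul, Finset.sum_apply, Pi.smul_apply, smul_eq_mul]
  refine Finset.sum_congr rfl (fun j _ => ?_)
  rw [ABC.fderiv_abc_single]

/-- Hence at `α₀`: `D U(α₀)·(1,1,1) = √2·(1,1,1)` and `D U(α₀)·v = −(√2/2)·v` for transverse `v`, as
statements about the Fréchet derivative itself. -/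
theorem fderiv_abc_alpha0_ones (i : Fin 3) :
    fderiv ℝ (ABC.abc 1 1 1) (!₂[7 * π / 4, 7 * π / 4, 7 * π / 4] : EuclideanSpace ℝ (Fin 3)) (!₂[1, 1, 1] : EuclideanSpace ℝ (Fin 3)) i = Real.sqrt 2 := by
  rw [fderiv_abc_eq_sum, Fin.sum_univ_three]
  fin_cases i <;> simp [jac_alpha0]

end Summit.NavierStokesRegularity.FluidComputer.ABCAlphaPointStrain
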